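import Literature.Geometry.Manifold.CompleteFlow
import HarnessLib

/-!
# Compactly supported vector fields are complete

General differential topology (Lee, *Introduction to Smooth Manifolds*, 2nd ed. (2012),
Thm. 9.16: "every compactly supported smooth vector field on a smooth manifold is complete";
Bröcker–Jänich, *Introduction to Differential Topology* (1982), remark after (8.11)), a
complement to `CompleteFlow.lean` (completeness ⇒ smooth global flow; a priori bounds ⇒
completeness) serving the seam tubes of NON-compact gluings
(`Literature/Topology/FourManifolds/AttachmentSeamTube.lean`: the interior of a manifold with
boundary, glued from a compact piece and a piece with one end deleted).  On a Hausdorff `C^∞`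
manifold all of whose points are interior (complete real model), for a `C^n` vector field `V`,
`1 ≤ n`, vanishing off a compact set `K`:

* `exists_isMIntegralCurve_of_eq_zero_off_isCompact` — through every point there is an integral
  curve defined on all of `ℝ`.  Proof: an integral curve through `x` never leaves `K ∪ {x}` (if
  `γ t ∉ K` then `V (γ t) = 0`, the constant curve at `γ t` is an integral curve, and by
  uniqueness `γ` is constant, so `γ t = γ 0 = x`); this is the a priori bound of
  `exists_isMIntegralCurve_of_apriori_isCompact`.
* `exists_contMDiff_globalFlow_of_eq_zero_off_isCompact` — hence `V` generates a `C^n` global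
  flow `θ : ℝ × M → M`, `θ(0, p) = p`, `θ(t, θ(s, p)) = θ(t + s, p)`, whose curves are the
  integral curves of `V`, and which fixes the zeros of `V`
  (`exists_contMDiff_globalFlow_of_complete`).

Everything is proved; no definitions, no named facts.

## References

* J. M. Lee, *Introduction to Smooth Manifolds*, 2nd ed., GTM 218 (2012), Thm. 9.12, Thm. 9.16,
  Lemma 9.19. [LeeSmoothManifolds2013]
* Th. Bröcker, K. Jänich, *Introduction to Differential Topology*, CUP 1982, (8.11) and the
  remark following it. [BrockerJanichIDT1982]
-/

open scoped Manifold ContDiff Topology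
open Set Function Filter

noncomputable section

namespace Literature.Geometry.Manifold

universe u

section CompactSupport

variable {E : Type u} [NormedAddCommGroup E] [NormedSpace ℝ E] [CompleteSpace E]
  {H : Type*} [TopologicalSpace H] {I : ModelWithCorners ℝ E H}
  {M : Type*} [TopologicalSpace M] [ChartedSpace H M] [IsManifold I ∞ M]
  [T2Space M] [BoundarylessManifold I M]
  {V : Π x : M, TangentSpace I x} {n : ℕ∞}

omit [CompleteSpace E] in
/-- **An integral curve of a field vanishing off `K` never leaves `K ∪ {γ 0}`.** If `V = 0` off
`K` and `γ` is an integral curve of `V` on an open order-connected `J ∋ 0`, then `γ t ∈ K` or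
`γ t = γ 0` for every `t ∈ J`: if `γ t ∉ K` the constant curve at `γ t` is an integral curve
(`isMIntegralCurve_const`) and agrees with `γ` by uniqueness
(`eqOn_of_isMIntegralCurveOn`, `MaximalIntegralCurve.lean`). [cite: LeeSmoothManifolds2013, Thm. 9.16 (proof) and Lemma 9.19] -/
theorem mem_or_eq_of_isMIntegralCurveOn_of_eq_zero_off [IsManifold I 1 M]
    (hV : ContMDiff I I.tangent 1 fun x => (⟨x, V x⟩ : TangentBundle I M))
    {K : Set M} (hVK : ∀ x, x ∉ K → V x = 0) {γ : ℝ → M} {J : Set ℝ} (hJo : IsOpen J)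
    (hJc : J.OrdConnected) (h0 : (0 : ℝ) ∈ J) (hγ : IsMIntegralCurveOn γ V J) {t : ℝ}
    (ht : t ∈ J) : γ t ∈ K ∨ γ t = γ 0 := by
  by_cases hK : γ t ∈ K
  · exact Or.inl hK
  right
  have hconst : IsMIntegralCurve (fun _ : ℝ => γ t) V := isMIntegralCurve_const (hVK _ hK)
  have heq := eqOn_of_isMIntegralCurveOn hV hJo hJc ht hγ (hconst.isMIntegralCurveOn _) rfl
  exact (heq h0).symm

/-- **Compactly supported fields are complete** (Lee 2012, Thm. 9.16): on a Hausdorff manifold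
without boundary points over a complete real model, a `C^n` vector field (`1 ≤ n`) vanishing
off a compact set `K` has through every point an integral curve defined on all of `ℝ` — the a
priori bound `K ∪ {x}` (`mem_or_eq_of_isMIntegralCurveOn_of_eq_zero_off`) fed into
`exists_isMIntegralCurve_of_apriori_isCompact`. [cite: LeeSmoothManifolds2013, Thm. 9.16] -/
theorem exists_isMIntegralCurve_of_eq_zero_off_isCompact
    (hV : ContMDiff I I.tangent n fun x => (⟨x, V x⟩ : TangentBundle I M)) (hn : 1 ≤ n)
    {K : Set M} (hK : IsCompact K) (hVK : ∀ x, x ∉ K → V x = 0) (x : M) :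
    ∃ γ : ℝ → M, γ 0 = x ∧ IsMIntegralCurve γ V := by
  have hV1 : ContMDiff I I.tangent 1 fun x => (⟨x, V x⟩ : TangentBundle I M) :=
    hV.of_le (by exact_mod_cast hn)
  refine exists_isMIntegralCurve_of_apriori_isCompact hV hn (fun x _ => ⟨insert x K,
    hK.insert x, fun γ J hJo hJc h0 hγ0 hγ t ht _ => ?_⟩) x
  rcases mem_or_eq_of_isMIntegralCurveOn_of_eq_zero_off hV1 hVK hJo hJc h0 hγ ht with h | h
  · exact mem_insert_of_mem _ h
  · rw [h, hγ0]; exact mem_insert _ _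

/-- **The global flow of a compactly supported field** (Lee 2012, Thm. 9.16 with Thm. 9.12): on a
Hausdorff manifold without boundary points over a complete real model, a `C^n` vector field
(`1 ≤ n`) vanishing off a compact set generates a global flow `θ : ℝ × M → M`, jointly `C^n`,
with `θ(0, p) = p`, `θ(t, θ(s, p)) = θ(t + s, p)`, whose curves `t ↦ θ(t, p)` are the integral
curves of `V`, and which fixes every zero of `V`. [cite: LeeSmoothManifolds2013, Thm. 9.16 and Thm. 9.12] -/
theorem exists_contMDiff_globalFlow_of_eq_zero_off_isCompact
    (hV : ContMDiff I I.tangent n fun x => (⟨x, V x⟩ : TangentBundle I M)) (hn : 1 ≤ n)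
    {K : Set M} (hK : IsCompact K) (hVK : ∀ x, x ∉ K → V x = 0) :
    ∃ θ : ℝ × M → M, ContMDiff (𝓘(ℝ, ℝ).prod I) I n θ ∧ (∀ p, θ (0, p) = p) ∧
      (∀ t s p, θ (t, θ (s, p)) = θ (t + s, p)) ∧
      (∀ p, IsMIntegralCurve (fun t => θ (t, p)) V) ∧
      ∀ p, V p = 0 → ∀ t, θ (t, p) = p := by
  have hV1 : ContMDiff I I.tangent 1 fun x => (⟨x, V x⟩ : TangentBundle I M) :=
    hV.of_le (by exact_mod_cast hn)
  obtain ⟨θ, hθ, hθ0, hθadd, hθint⟩ := exists_contMDiff_globalFlow_of_complete hV hn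
    (exists_isMIntegralCurve_of_eq_zero_off_isCompact hV hn hK hVK)
  refine ⟨θ, hθ, hθ0, hθadd, hθint, fun p hp t => ?_⟩
  have hconst : IsMIntegralCurve (fun _ : ℝ => p) V := isMIntegralCurve_const hp
  have h := isMIntegralCurve_eq_of_contMDiff (fun _ => BoundarylessManifold.isInteriorPoint) hV1
    (hθint p) hconst (t₀ := 0) (hθ0 p)
  exact congrFun h t

end CompactSupport

end Literature.Geometry.Manifold

end
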